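import Literature.NumberTheory.EllipticCurves.BurungaleCastellaSkinner2025.ProductDivisibilities
import Literature.NumberTheory.EllipticCurves.YanZhu2026.GreenbergDivisibilityProofs
import HarnessLib

/-!
# Burungale–Castella–Skinner 2025, proof of Prop. 5.2.1, the INTEGRALITY step (p. 10): "Since
# `μ(L_p^Gr(g/K)·L_p^Gr(g_F/K)) = 0` by Proposition 4.2.2, the divisibility (5.1) holds integrally in
# `Λ_K^ur`. By again appealing to Proposition 4.1.3, the proof concludes." — PROVED

`Proofs` companion (theorems only: no definition, no named fact, no instance) of
`ProductDivisibilities.lean` (seat `bsd-littype-03`, gen 4: the named facts `cor414_…` = Cor. 4.1.4 and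
`prop521_…` = Prop. 5.2.1) and of `YanZhu2026/GreenbergDivisibilityProofs.lean` (seat `bsd-littype-04`,
gen 5: the cancellation theorem `le_span_of_span_map_C_mul_le_of_hasUnitContent_minus`).

A. Burungale, F. Castella, C. Skinner, *Base change and Iwasawa main conjectures for GL₂*, IMRN 2025
rnaf082 = arXiv:2405.00270v2, proof of **Proposition 5.2.1**, last paragraph (p. 10,
`[corpus: paper:arxiv-2405.00270 p0010 L36–L54]`), verbatim:

> "… and so by Lemmas 5.1.1 and 5.1.2, we have
> `(L_p^PR(g/K)·L_p^PR(g_F/K)) ⊃ ch_{Λ_K}(X_ord(g/K)) · ch_{Λ_K}(X_ord(g_F/K))` in `Λ_K ⊗ ℚ_p`. In turn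
> Proposition 4.1.3 (and its proof) implies
> `(L_p^Gr(g/K)·L_p^Gr(g_F/K)) ⊃ ch_{Λ_K}(X_Gr(g/K)) · ch_{Λ_K}(X_Gr(g_F/K))` (5.1) in `Λ_K^ur ⊗ ℚ_p`.
> Since `μ(L_p^Gr(g/K)·L_p^Gr(g_F/K)) = 0` by Proposition 4.2.2, the divisibility (5.1) holds integrally
> in `Λ_K^ur`. By again appealing to Proposition 4.1.3, the proof concludes."

WHAT IS PROVED (`idealLeSpan_product_of_rational_of_cor414`): in the currency of `cor414_…` /
`prop521_…` — two curves `E = W`, `E′ = W′` with parametrisations `π, π′`, `GreenbergSetting` for both,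
(irr_K) for both, type-I frames `F, F′`, one Katz frame `LK` with Greenberg series `G, G′` at
`(γ₁⁻¹, γ₂⁻¹)`, a structure-compatible `J` — granted the named fact `cor414_…` (Cor. 4.1.4, the tree's
form of "Proposition 4.1.3 (and its proof)" for products): the RATIONAL ordinary product divisibility
"`(L·L′) ⊃ ch·ch′` in `Λ_K ⊗ ℚ_p`" (`IdealLeSpanAway (p : Λ_K) (ch·ch′) (L·L′)`: after inverting `p`)
together with `μ(G⁻) = μ(G′⁻) = 0` (`HasUnitContent (minus G)`, `HasUnitContent (minus G′)` — the
conclusion of Prop. 4.2.2 for each factor, available as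
`hasUnitContent_minus_of_prop314AnyRoot_of_prop422` under (Heeg)) imply the INTEGRAL divisibilities:
`IdealLeSpan (ch·ch′) (L·L′)` in `Λ_K` and `(ch_Gr·ch_Gr′)𝒪_{ℂ_p}⟦T₁,T₂⟧ ⊆ (G·G′)`. The step "`μ = 0` ⟹
(5.1) holds integrally" is the case `t = pⁿ` of the cancellation theorem
`le_span_of_span_map_C_mul_le_of_hasUnitContent_minus` ([YZ26] proof of Thm. 4.2 (2), second step), with
`μ` of a product handled by `hasUnitContent_mul` (Gauss's lemma modulo `𝔪`: `k⟦T⟧` is a domain).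

What is NOT here: the first half of the printed proof (Wan's divisibility over `M = FK`, Thm. 3.2.1,
and Lemmas 5.1.1–5.1.2), which is why `prop521_…` stays a named fact; this file only certifies in the
kernel that its last paragraph follows from Cor. 4.1.4 + Prop. 4.2.2 as printed (0 new facts).

## References
* [BurungaleCastellaSkinner2025] arXiv:2405.00270v2, proof of Prop. 5.2.1 (p. 10, L36–L54); Cor. 4.1.4
  (p. 8); Prop. 4.2.2 (p. 9).
* [YanZhu2024MainConjNonCM] arXiv:2412.20078v4, proof of Thm. 4.2 (2) (l.1042–1050) — the cancellation.
* [GreenbergVatsal2000] p. 2, (2) — `μ = 0` as "some coefficient is a unit".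
-/

noncomputable section

open scoped Classical

open PowerSeries NumberField IsDedekindDomain Field CongruenceSubgroup
  Literature.NumberTheory.GaloisRepresentations Literature.NumberTheory.EllipticCurves
  Literature.NumberTheory.EllipticCurves.ModularForms Literature.NumberTheory.EllipticCurves.Rank1Residual
  Literature.NumberTheory.EllipticCurves.IwasawaAlgebra₂ Literature.NumberTheory.EllipticCurves.YanZhu2026
  Literature.NumberTheory.EllipticCurves.UnrSeries₂ Literature.NumberTheory.EllipticCurves.GreenbergVatsal2000

namespace Literature.NumberTheory.EllipticCurves

/-! ## §1. `μ` of a product; cancelling a power of `p` against `μ⁻ = 0` -/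

section MuProduct

/-- **`μ(fg) = 0` iff `μ(f) = μ(g) = 0`, the easy half**: over a local ring, if `f` and `g` each have a
unit coefficient then so does `f·g` (reduce modulo the maximal ideal: `k⟦T⟧` is a domain). This is how
"`μ(L_p^Gr(g/K)·L_p^Gr(g_F/K)) = 0` by Proposition 4.2.2" is read (Prop. 4.2.2 is about each factor).
[cite: BurungaleCastellaSkinner2025, proof of Prop. 5.2.1 (p. 10 of arXiv:2405.00270v2, "μ(L_p^Gr(g/K)·L_p^Gr(g_F/K)) = 0 by Proposition 4.2.2")]
[cite: GreenbergVatsal2000, p. 2, (2)] -/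
theorem hasUnitContent_mul {R : Type*} [CommRing R] [IsLocalRing R] {f g : PowerSeries R}
    (hf : HasUnitContent f) (hg : HasUnitContent g) : HasUnitContent (f * g) := by
  rw [hasUnitContent_iff_map_residue_ne_zero] at hf hg ⊢
  rw [map_mul]
  exact mul_ne_zero hf hg

variable {p : ℕ} [Fact p.Prime]

/-- `μ((G·G′)⁻) = 0` from `μ(G⁻) = μ(G′⁻) = 0` (`⁻` is multiplicative).
[cite: BurungaleCastellaSkinner2025, proof of Prop. 5.2.1 (p. 10 of arXiv:2405.00270v2)] -/
theorem hasUnitContent_minus_mul {G G' : PowerSeries (PowerSeries (PadicComplexInt p))}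
    (hG : HasUnitContent (minus G)) (hG' : HasUnitContent (minus G')) : HasUnitContent (minus (G * G')) := by
  rw [minus_mul]
  exact hasUnitContent_mul hG hG'

/-- `p ≠ 0` in `𝒪_{ℂ_p}`. [cite: BurungaleCastellaSkinner2025, proof of Prop. 5.2.1 (p. 10 of arXiv:2405.00270v2, "in Λ_K^ur ⊗ ℚ_p") — bookkeeping] -/
theorem natCast_prime_padicComplexInt_ne_zero : ((p : ℕ) : PadicComplexInt p) ≠ 0 := by
  intro h
  have h' : ((p : ℕ) : ℂ_[p]) = 0 := by exact_mod_cast congrArg ((↑) : PadicComplexInt p → ℂ_[p]) h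
  exact (Nat.cast_ne_zero.mpr (Fact.out : p.Prime).ne_zero) h'

/-- **"Since `μ = 0`, the divisibility holds integrally"**: in `𝒪_{ℂ_p}⟦T₁⟧⟦T₂⟧`, if `pⁿ·𝔞 ⊆ (G)` and
`μ(G⁻) = 0` then `𝔞 ⊆ (G)` — the case `t = pⁿ` (a constant cyclotomic series) of the cancellation theorem
`le_span_of_span_map_C_mul_le_of_hasUnitContent_minus`.
[cite: BurungaleCastellaSkinner2025, proof of Prop. 5.2.1 (p. 10 of arXiv:2405.00270v2, "Since μ(…) = 0 by Proposition 4.2.2, the divisibility (5.1) holds integrally in Λ_K^ur")]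
[cite: YanZhu2024MainConjNonCM, proof of Thm. 4.2 (2) (arXiv:2412.20078v4 TeX l.1042–1050)] -/
theorem le_span_of_span_natCast_pow_mul_le_of_hasUnitContent_minus
    {G : PowerSeries (PowerSeries (PadicComplexInt p))} (hG : HasUnitContent (minus G))
    {𝔞 : Ideal (PowerSeries (PowerSeries (PadicComplexInt p)))} {n : ℕ}
    (h : Ideal.span {((p : ℕ) : PowerSeries (PowerSeries (PadicComplexInt p))) ^ n} * 𝔞 ≤ Ideal.span {G}) :
    𝔞 ≤ Ideal.span {G} := by
  have ht : ((p : ℕ) : PowerSeries (PadicComplexInt p)) ^ n ≠ 0 := by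
    refine pow_ne_zero n ?_
    rw [← map_natCast (PowerSeries.C (R := PadicComplexInt p)), Ne,
      ← map_zero (PowerSeries.C (R := PadicComplexInt p)), (PowerSeries.C_injective).eq_iff]
    exact natCast_prime_padicComplexInt_ne_zero
  refine le_span_of_span_map_C_mul_le_of_hasUnitContent_minus hG ht ?_
  rwa [map_pow, map_natCast]

/-- The localising element `p ∈ Λ_K` of `cor414_…` / `thm413_…` ("in `⊗ ℚ_p`") extends to the constant
`p` of `𝒪_{ℂ_p}⟦T₁⟧⟦T₂⟧`. [cite: BurungaleCastellaSkinner2025, proof of Prop. 5.2.1 (p. 10 of arXiv:2405.00270v2) — bookkeeping] -/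
theorem toUnr₂_natCast (J : ℤ_[p] →+* PadicComplexInt p) (m : ℕ) :
    toUnr₂ p J (m : IwasawaAlgebra₂ p) = (m : PowerSeries (PowerSeries (PadicComplexInt p))) :=
  map_natCast _ m

end MuProduct

end Literature.NumberTheory.EllipticCurves

/-! ## §2. Prop. 5.2.1, last paragraph: rational product divisibility + `μ = 0` ⟹ integral, both sides -/

namespace Literature.NumberTheory.EllipticCurves.BurungaleCastellaSkinner2025

variable {p : ℕ} [Fact p.Prime]

/-- **BCS 2025, proof of Prop. 5.2.1, last paragraph (p. 10) — PROVED from Cor. 4.1.4 and `μ = 0`**: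
for two curves `E = W`, `E′ = W′` (parametrisations `π, π′`; `GreenbergSetting` and (irr_K) for both),
type-I frames `F, F′`, a Katz frame `LK` with Greenberg series `G, G′` at `(γ₁⁻¹, γ₂⁻¹)` and a
structure-compatible `J`, granted the named fact `cor414_…`: IF the ordinary product divisibility holds
"in `Λ_K ⊗ ℚ_p`" (`IdealLeSpanAway p (ch(X_ord)·ch(X_ord′)) (L_p^PR·L_p^PR′)`) AND `μ(G⁻) = μ(G′⁻) = 0`,
THEN "(5.1) holds integrally in `Λ_K^ur`" (`(ch(X_Gr)·ch(X_Gr′))𝒪_{ℂ_p}⟦T₁,T₂⟧ ⊆ (G·G′)`) AND, "by again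
appealing to" Cor. 4.1.4 (at `S = {1}`), the INTEGRAL ordinary product divisibility
`IdealLeSpan (ch(X_ord)·ch(X_ord′)) (L_p^PR·L_p^PR′)` — the two conclusions of `prop521_…`. The `μ = 0`
inputs are those of Prop. 4.2.2 (tree: `hasUnitContent_minus_of_prop314AnyRoot_of_prop422`, under (Heeg)).
[cite: BurungaleCastellaSkinner2025, proof of Prop. 5.2.1, last paragraph (p. 10 of arXiv:2405.00270v2, L36–L54) with Cor. 4.1.4 (p. 8) and Prop. 4.2.2 (p. 9)] -/
theorem idealLeSpan_product_of_rational_of_cor414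
    (h414 : cor414_product_ord_localised_iff_greenberg_localised)
    (ι₁ : integralClosure ℚ ℂ →+* ℂ_[p]) (ι : PadicAlgCl p ≃+* ℂ) (W W' : WeierstrassCurve ℚ)
    [W.IsElliptic] [W.IsGloballyMinimal] [W'.IsElliptic] [W'.IsGloballyMinimal] (K : Type) [Field K]
    [NumberField K] (v vbar : HeightOneSpectrum (𝓞 K)) (κ₁ κ₂ : ZpExtension K p)
    (γ₁ γ₂ : absoluteGaloisGroup K) [Fact (ZpExtension.IsTopGeneratorPair κ₁ κ₂ γ₁ γ₂)] {N N' : ℕ}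
    [NeZero N] [NeZero N'] (π : ModularParametrizationData W N) (π' : ModularParametrizationData W' N')
    [NeZero (NumberField.discr K).natAbs]
    (hS : GreenbergSetting ι W N K v vbar κ₁ κ₂) (hS' : GreenbergSetting ι W' N' K v vbar κ₁ κ₂)
    (hirr : (W.baseChange K).HasIrreducibleModPGaloisRep p)
    (hirr' : (W'.baseChange K).HasIrreducibleModPGaloisRep p)
    (hι : ∀ z : integralClosure ℚ ℂ, ι₁ z = ((ι.symm (z : ℂ) : PadicAlgCl p) : ℂ_[p]))
    {F F' : CycAntiSeries p} (hF : IsHidaRankinLFunction ι₁ W κ₁ κ₂ π.f F) (hcF : IsCongruenceIntegral π.f F)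
    (hF' : IsHidaRankinLFunction ι₁ W' κ₁ κ₂ π'.f F') (hcF' : IsCongruenceIntegral π'.f F')
    {Ω δ : ℂ} {Ωp : (unrIntegers p)ˣ} {LK G G' : PowerSeries (PowerSeries (PadicComplexInt p))}
    (hLK : IsKatzMeasure₂ ι v vbar ∅ κ₁ κ₂ γ₁⁻¹ γ₂⁻¹ 1 Ω δ ((Ωp : unrIntegers p) : ℂ_[p]) LK)
    (hG : IsGreenbergLFunctionAnyRoot₂ ι v vbar κ₁ κ₂ γ₁⁻¹ γ₂⁻¹ π.f (NumberField.discr K).natAbs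
      (NumberField.classNumber K) LK G)
    (hG' : IsGreenbergLFunctionAnyRoot₂ ι v vbar κ₁ κ₂ γ₁⁻¹ γ₂⁻¹ π'.f (NumberField.discr K).natAbs
      (NumberField.classNumber K) LK G')
    (J : ℤ_[p] →+* PadicComplexInt p)
    (hJ : ∀ x : ℤ_[p], ((J x : PadicComplexInt p) : ℂ_[p]) = ((x : ℚ_[p]) : ℂ_[p]))
    -- `μ(L_p^Gr(g/K)) = μ(L_p^Gr(g_F/K)) = 0` (Prop. 4.2.2 for each factor)
    (hμ : HasUnitContent (minus G)) (hμ' : HasUnitContent (minus G'))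
    -- the RATIONAL ordinary product divisibility ("in Λ_K ⊗ ℚ_p")
    (hrat : IdealLeSpanAway (p : IwasawaAlgebra₂ p)
      (WeierstrassCurve.XOrd₂.charIdeal (W.baseChange K) p κ₁ κ₂ γ₁ γ₂ *
        WeierstrassCurve.XOrd₂.charIdeal (W'.baseChange K) p κ₁ κ₂ γ₁ γ₂)
      (perrinRiouLFunction W π F * perrinRiouLFunction W' π' F')) :
    IdealLeSpan
        (WeierstrassCurve.XOrd₂.charIdeal (W.baseChange K) p κ₁ κ₂ γ₁ γ₂ *
          WeierstrassCurve.XOrd₂.charIdeal (W'.baseChange K) p κ₁ κ₂ γ₁ γ₂)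
        (perrinRiouLFunction W π F * perrinRiouLFunction W' π' F') ∧
      (WeierstrassCurve.XGr₂.charIdeal (W.baseChange K) p κ₁ κ₂ vbar γ₁ γ₂).map (toUnr₂ p J) *
          (WeierstrassCurve.XGr₂.charIdeal (W'.baseChange K) p κ₁ κ₂ vbar γ₁ γ₂).map (toUnr₂ p J) ≤
        Ideal.span {G * G'} := by
  have hp0 : (p : IwasawaAlgebra₂ p) ≠ 0 := by
    intro h
    have h1 := congrArg (toUnr₂ p J) h
    rw [toUnr₂_natCast, map_zero, ← map_natCast (PowerSeries.C (R := PowerSeries (PadicComplexInt p))),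
      ← map_zero (PowerSeries.C (R := PowerSeries (PadicComplexInt p))),
      (PowerSeries.C_injective).eq_iff, ← map_natCast (PowerSeries.C (R := PadicComplexInt p)),
      ← map_zero (PowerSeries.C (R := PadicComplexInt p)), (PowerSeries.C_injective).eq_iff] at h1
    exact natCast_prime_padicComplexInt_ne_zero h1
  -- "Proposition 4.1.3 (and its proof) implies (5.1) in `Λ_K^ur ⊗ ℚ_p`"
  obtain ⟨n, hn⟩ := ((h414 ι₁ ι W W' K v vbar κ₁ κ₂ γ₁ γ₂ π π' hS hS' hirr hirr' hι F F' hF hcF hF' hcF'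
    Ω δ Ωp LK G G' hLK hG hG' J hJ (p : IwasawaAlgebra₂ p) hp0).1).mp hrat
  -- "Since `μ(…) = 0` …, (5.1) holds integrally in `Λ_K^ur`"
  rw [toUnr₂_natCast] at hn
  have hint := le_span_of_span_natCast_pow_mul_le_of_hasUnitContent_minus
    (hasUnitContent_minus_mul hμ hμ') hn
  -- "By again appealing to Proposition 4.1.3 [Cor. 4.1.4 at `S = {1}`], the proof concludes."
  refine ⟨?_, hint⟩
  have h1 := ((h414 ι₁ ι W W' K v vbar κ₁ κ₂ γ₁ γ₂ π π' hS hS' hirr hirr' hι F F' hF hcF hF' hcF' Ω δ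
    Ωp LK G G' hLK hG hG' J hJ 1 one_ne_zero).1).mpr ⟨0, by simpa using hint⟩
  exact idealLeSpanAway_one_iff.mp h1

end Literature.NumberTheory.EllipticCurves.BurungaleCastellaSkinner2025

end
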